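import Summits.HodgeConjecture.CorCM.MultiFieldWeilOcticSlotsDegreeForm
import HarnessLib

/-!
# MULTI-FIELD WEIL ENGINE — THE 𝔖₄ LEMMA: non-isomorphic OCTIC CM fields through `k`, one of them with `2`-transitive quartic part, lie outside
# each other's Galois closures

Cell `pub-hodgecm2` (COR-CM), seat b30 gen 39 (2026-08-25); count-neutral own lane MULTI-FIELD WEIL ENGINE (stem `MultiFieldWeil*`), sequel of
`CorCM/MultiFieldWeilOcticSlotsHeadline.lean` (Z3: the sextic + octic + decic headline, octic pairs under «a value outside the closure») and
`CorCM/MultiFieldWeilQuarticSlotMovers.lean` (Z2: `2`-transitive quartic slots).  Theorems only; no definition, no named fact, no `sorry`, no Markman binder; `HC_CM` is NOT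
touched.

THE POINT.  Z3's headline asks, for two OCTIC slots `m₀ ≠ m`, that some `τ`-embedding of `K_m` take a value outside `L(K_{m₀})`; for sextic and decic pairs W1 §3 and
Y1 §1 reduced this to `Hom(K_m, K_{m₀}) = ∅` by degree chases (`18 ∤ 12`, `25 ∤ 3840`).  For octic fields a degree chase is not enough (`16 ∣ 48`); the group theory
is: in a group acting faithfully and `2`-transitively on four letters (`𝔄₄` or `𝔖₄`) EVERY subgroup of index `4` is a point stabiliser (an element of order `3` of a
subgroup of order `3` or `6` fixes exactly one letter, and an orbit through that letter of size `4` would have to divide `3` or `6`).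

§1 GROUP THEORY (`exists_forall_apply_eq_of_card_three_or_six`, `exists_apply_eq_iff_of_ker_le_of_twoTransitive_four`): `φ₀ : G → Sym(α)`, `|α| = 4`, with
`2`-transitive image; `φ : G → Sym(β)`, `|β| = 4`, with transitive image; `ker φ₀ ≤ ker φ`.  Then for every `a ∈ β` there is `b ∈ α` with `Stab_φ(a) = Stab_{φ₀}(b)`.
§2 MODEL (`exists_apply_eq_iff_of_noMover_four`): the same read on `R ⊆ ∏_l Sym(n_l)` — two slots of size `4`, `R` `2`-transitive on `m₀`, NO mover from `m₀` to `m`.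
§3 TWO BRIDGES (`apply_eq_self_of_mem_normalClosure`: an automorphism of `ℂ` fixing every complex embedding of `K` fixes `L(K)` pointwise — `L(K)` is generated by their
images; `comp_eq_of_forall_comp_eq_over`: for a CM field `K ⊇ i(k)`, `k` imaginary quadratic, fixing the `τ`-embeddings suffices — the others are `ū = u ∘ c_K`).
§4 **THE 𝔖₄ LEMMA** (`exists_outside_normalClosure_of_isEmpty_ringHom_four`): `k = Kf i₀` imaginary quadratic, `K_{m₀}`, `K_m` OCTIC CM fields through `k`
(`[K_l : k] = n_l` along `i_l`, `n_{m₀} = n_m = 4`), the automorphisms of `ℂ` over `τ(k)` `2`-TRANSITIVE on the four `τ`-embeddings of `K_{m₀}` (quartic part `𝔄₄` or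
`𝔖₄`), and `Hom(K_m, K_{m₀}) = ∅`.  Then some `τ`-embedding (indeed every complex embedding, `forall_exists_outside_normalClosure_of_isEmpty_ringHom_four`) of `K_m`
takes a value outside `L(K_{m₀})`.  PROOF.  Otherwise every realised tuple trivial at `m₀` is trivial at `m` (§3), so by §1–§2 the `τ`-embedding `s` of `K_m` at a position `a` and the
`τ`-embedding `u` of `K_{m₀}` at the matching position `b` have ONE stabiliser in `Aut(ℂ/τk)`; then `s(K_m) ⊆ u(K_{m₀})` (a value of `s` outside `u(K_{m₀})` is moved by an
automorphism fixing `u(K_{m₀})`, gen 31's `exists_ringEquiv_fix_comp_ne_of_apply_not_mem`, which fixes `u`, hence `s`), and `u⁻¹ ∘ s ∈ Hom(K_m, K_{m₀})`.  (For quartic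
part `D₄` this is FALSE — the dihedral closure contains non-conjugate subfields of index `4`, e.g. `k·ℚ(√(a+b√d))` and its sisters; for `C₄`, `V₄` it holds trivially,
`L(K_{m₀})` having degree `8`, but there `2`-transitivity fails and the engine's quartic slots are not available.)
The geometric consumers (Z3's sextic + octic + decic headline, Z4's octic headline, Y6's quotable form and T3c's twins menu with `Hom = ∅` for ALL pairs of equal degree)
are in the sequel `CorCM/MultiFieldWeilNonIsomorphicMenu.lean`; this file is pure group ∕ field theory and touches no Markman binder.

[cite: DixonMortimer1996, §1.4 Ex. 1.4.1–1.4.2, §1.6 Thm. 1.6A; §2.1] [cite: Wielandt1964, §9–§10] [cite: Lang2002, I §6 Thm. 6.2 (Cauchy); VI §1 Thm. 1.1, Cor. 1.6; V §2 Thm. 2.8]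
[cite: Shimura1998, §18.2 Lemma (i)]

## References
* [DixonMortimer1996] J. D. Dixon, B. Mortimer, *Permutation Groups*, GTM 163, §1.4 (orbits and stabilisers: `|G| = |x^G| |G_x|`), §1.6 Thm. 1.6A, §2.1 (`2`-transitivity).
* [Wielandt1964] H. Wielandt, *Finite permutation groups*, §9–§10.  [Lang2002] S. Lang, *Algebra*, GTM 211, I §6 Thm. 6.2 (Cauchy), V §2 Thm. 2.8, VI §1 Thm. 1.1, Cor. 1.6.
* [Shimura1998] G. Shimura, *Abelian varieties with complex multiplication and modular functions*, §18.2 Lemma (i).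
-/

noncomputable section

open CategoryTheory CategoryTheory.Limits NumberField IntermediateField

namespace Summit.HodgeConjecture.CorCM.MultiFieldWeil

open Finset
open Literature.AlgebraicGeometry Literature.AlgebraicGeometry.Motives Literature.AlgebraicGeometry.HodgeTheory
open Literature.AlgebraicGeometry.ComplexMultiplication (IsCMTypeRealisation)
open Literature.AlgebraicTopology.SingularHomology
open Literature.NumberTheory.ComplexMultiplication
open Summit.HodgeConjecture.CorCM.Census.MultiFieldWeil

open scoped Classical

/-! ## §1 Group theory: index-`4` subgroups of a faithful `2`-transitive group on four letters are point stabilisers -/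

section Group

variable {G : Type} [Group G]

/-- **An element of order `3` of `Sym(α)`, `|α| = 4`, is a `3`-cycle: it fixes exactly one letter and moves the other three.** [cite: DixonMortimer1996, §1.4] -/
theorem isCycle_and_exists_fixed_of_orderOf_three {α : Type} [Fintype α] [DecidableEq α] (hα : Fintype.card α = 4) {σ : Equiv.Perm α}
    (hσ : orderOf σ = 3) : σ.IsCycle ∧ ∃ b : α, σ b = b ∧ ∀ x, x ≠ b → σ x ≠ x := by
  obtain ⟨j, hj⟩ := Equiv.Perm.cycleType_prime_order (σ := σ) (by rw [hσ]; exact Nat.prime_three)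
  rw [hσ] at hj
  have hsum := Equiv.Perm.sum_cycleType σ
  rw [hj, Multiset.sum_replicate, smul_eq_mul] at hsum
  have hle : σ.support.card ≤ 4 := hα ▸ Finset.card_le_univ _
  obtain rfl : j = 0 := by omega
  have hcyc : σ.IsCycle := Equiv.Perm.card_cycleType_eq_one.1 (by rw [hj, Multiset.card_replicate])
  have hc : σ.supportᶜ.card = 1 := by rw [Finset.card_compl, hα]; omega
  obtain ⟨b, hb⟩ := Finset.card_eq_one.1 hc
  refine ⟨hcyc, b, ?_, fun x hx => ?_⟩
  · have h : b ∈ σ.supportᶜ := by rw [hb]; exact Finset.mem_singleton_self b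
    rwa [Finset.mem_compl, Equiv.Perm.mem_support, not_not] at h
  · have h : x ∉ σ.supportᶜ := by rw [hb, Finset.mem_singleton]; exact hx
    rwa [Finset.mem_compl, not_not, Equiv.Perm.mem_support] at h

/-- **A subgroup of `Sym(α)`, `|α| = 4`, of order `3` or `6` has a common fixed letter**: an element of order `3` (Cauchy) is a `3`-cycle fixing exactly one letter `b`;
if some element moved `b`, the orbit of `b` would be all four letters, of size `4 ∤ 3, 6`. [cite: DixonMortimer1996, §1.4 Ex. 1.4.1–1.4.2] [cite: Lang2002, I §6 Thm. 6.2] -/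
theorem exists_forall_apply_eq_of_card_three_or_six {α : Type} [Fintype α] [DecidableEq α] (hα : Fintype.card α = 4) (S : Subgroup (Equiv.Perm α))
    (hS : Nat.card S = 3 ∨ Nat.card S = 6) : ∃ b : α, ∀ h ∈ S, h b = b := by
  haveI : Fact (Nat.Prime 3) := ⟨Nat.prime_three⟩
  obtain ⟨g, hg⟩ := exists_prime_orderOf_dvd_card' (G := ↥S) 3 (by rcases hS with h | h <;> rw [h]; norm_num)
  obtain ⟨hcyc, b, -, hmov⟩ := isCycle_and_exists_fixed_of_orderOf_three hα (σ := (g : Equiv.Perm α)) (by rw [Subgroup.orderOf_coe, hg])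
  refine ⟨b, fun h hh => ?_⟩
  by_contra hne
  -- the orbit of `b` under `S` is everything
  have huniv : MulAction.orbit (↥S) b = Set.univ := by
    refine Set.eq_univ_of_forall fun c => ?_
    by_cases hc : c = b
    · rw [hc]; exact MulAction.mem_orbit_self b
    · obtain ⟨i, hi⟩ := hcyc.exists_zpow_eq (hmov _ hne) (hmov _ hc)
      refine MulAction.mem_orbit_iff.2 ⟨g ^ i * ⟨h, hh⟩, ?_⟩
      rw [Subgroup.smul_def, Equiv.Perm.smul_def, Subgroup.coe_mul, Subgroup.coe_zpow, Equiv.Perm.mul_apply]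
      exact hi
  have hdvd : (MulAction.stabilizer (↥S) b).index ∣ Nat.card S := Subgroup.index_dvd_card _
  rw [MulAction.index_stabilizer, huniv, Set.ncard_univ, Nat.card_eq_fintype_card, hα] at hdvd
  rcases hS with h | h <;> rw [h] at hdvd <;> revert hdvd <;> decide

/-- **INDEX-`4` SUBGROUPS OF A FAITHFUL `2`-TRANSITIVE GROUP ON FOUR LETTERS ARE POINT STABILISERS** (two-representation form).  `φ₀ : G → Sym(α)`, `|α| = 4`, with
`2`-TRANSITIVE image; `φ : G → Sym(β)`, `|β| = 4`, with transitive image; `ker φ₀ ≤ ker φ`.  Then for every `a ∈ β` some `b ∈ α` has `Stab_φ(a) = Stab_{φ₀}(b)`: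
`|φ₀(G)| ∈ {12, 24}`; `S = Stab_φ(a) ⊇ ker φ₀` has index `4`, so `φ₀(S)` has order `3` or `6` and a common fixed letter `b`; `S ≤ Stab_{φ₀}(b)`, both of index `4`.
[cite: DixonMortimer1996, §1.4 Ex. 1.4.1–1.4.2; §2.1] [cite: Wielandt1964, §9] -/
theorem exists_apply_eq_iff_of_ker_le_of_twoTransitive_four {α β : Type} [Fintype α] [DecidableEq α] [Fintype β] [DecidableEq β]
    (hα : Fintype.card α = 4) (hβ : Fintype.card β = 4) (φ₀ : G →* Equiv.Perm α) (φ : G →* Equiv.Perm β)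
    (h2t : ∀ a b c d : α, a ≠ b → c ≠ d → ∃ g : G, φ₀ g a = c ∧ φ₀ g b = d) (htr : ∀ x y : β, ∃ g : G, φ g x = y)
    (hker : φ₀.ker ≤ φ.ker) (a : β) : ∃ b : α, ∀ g : G, φ g a = a ↔ φ₀ g b = b := by
  -- `|φ₀(G)| ∈ {12, 24}`
  have h12 : 12 ∣ Nat.card φ₀.range := by
    have h := descFactorial_two_dvd_index_ker_of_twoTransitive (by rw [hα]; norm_num) φ₀ h2t
    have h12' : (Fintype.card α).descFactorial 2 = 12 := by rw [hα]; rfl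
    rwa [h12', Subgroup.index_ker] at h
  have h24 : Nat.card φ₀.range * φ₀.range.index = 24 := by
    rw [Subgroup.card_mul_index, Nat.card_perm, Nat.card_eq_fintype_card, hα]; rfl
  have hQ : (Nat.card φ₀.range = 12 ∧ φ₀.range.index = 2) ∨ (Nat.card φ₀.range = 24 ∧ φ₀.range.index = 1) := by
    obtain ⟨t, ht⟩ := h12
    rw [ht, mul_assoc] at h24
    have h2 : t * φ₀.range.index = 2 := Nat.eq_of_mul_eq_mul_left (by norm_num : 0 < 12) (h24.trans (by norm_num))
    rcases (Nat.dvd_prime Nat.prime_two).1 (Dvd.intro _ h2) with rfl | rfl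
    · exact Or.inl ⟨by rw [ht], by omega⟩
    · exact Or.inr ⟨by rw [ht], by omega⟩
  -- the `φ`-stabiliser `S` of `a`: index `4`, contains `ker φ₀`
  letI iβ : MulAction G β := MulAction.compHom β φ
  haveI : MulAction.IsPretransitive G β := ⟨fun x y => htr x y⟩
  set S : Subgroup G := MulAction.stabilizer G a with hSdef
  have hmemS : ∀ g, g ∈ S ↔ φ g a = a := fun g => MulAction.mem_stabilizer_iff
  have hSi : S.index = 4 := by rw [hSdef, MulAction.index_stabilizer_of_transitive, Nat.card_eq_fintype_card, hβ]
  have hkerS : φ₀.ker ≤ S := fun g hg => by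
    have h := hker hg
    rw [MonoidHom.mem_ker] at h
    rw [hmemS, h, Equiv.Perm.one_apply]
  -- its image `φ₀(S)` has order `3` or `6`, hence a common fixed letter `b`
  have hSbar : Nat.card (S.map φ₀) = 3 ∨ Nat.card (S.map φ₀) = 6 := by
    have h1 : (S.map φ₀).index = 4 * φ₀.range.index := by rw [Subgroup.index_map, sup_eq_left.2 hkerS, hSi]
    have h2 : Nat.card (S.map φ₀) * (S.map φ₀).index = 24 := by
      rw [Subgroup.card_mul_index, Nat.card_perm, Nat.card_eq_fintype_card, hα]; rfl
    rw [h1] at h2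
    rcases hQ with ⟨-, hi⟩ | ⟨-, hi⟩ <;> rw [hi] at h2
    · left; omega
    · right; omega
  obtain ⟨b, hb⟩ := exists_forall_apply_eq_of_card_three_or_six hα (S.map φ₀) hSbar
  -- `S ≤ Stab_{φ₀}(b)`, both of index `4`
  letI iα : MulAction G α := MulAction.compHom α φ₀
  haveI : MulAction.IsPretransitive G α := ⟨fun x y => by
    by_cases hxy : x = y
    · exact ⟨1, by rw [one_smul, hxy]⟩
    · obtain ⟨g, hg, -⟩ := h2t x y y x hxy (Ne.symm hxy)
      exact ⟨g, hg⟩⟩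
  set T : Subgroup G := MulAction.stabilizer G b with hTdef
  have hmemT : ∀ g, g ∈ T ↔ φ₀ g b = b := fun g => MulAction.mem_stabilizer_iff
  have hTi : T.index = 4 := by rw [hTdef, MulAction.index_stabilizer_of_transitive, Nat.card_eq_fintype_card, hα]
  have hST : S ≤ T := fun g hg => (hmemT g).2 (hb (φ₀ g) (Subgroup.mem_map_of_mem φ₀ hg))
  have hTS : T ≤ S := by
    have h := Subgroup.relIndex_mul_index hST
    rw [hSi, hTi] at h
    exact Subgroup.relIndex_eq_one.1 (by omega)
  exact ⟨b, fun g => ⟨fun h => (hmemT g).1 (hST ((hmemS g).2 h)), fun h => (hmemS g).1 (hTS ((hmemT g).2 h))⟩⟩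

end Group

/-! ## §2 Model: two slots of size `4`, no mover -/

section Model

variable {r : ℕ} {n : Fin r → ℕ} {R : Finset (PermsG n)}

/-- **TWO SLOTS OF SIZE `4`, `2`-TRANSITIVE ON `m₀`, NO MOVER FROM `m₀` TO `m`: every position of `m` has the stabiliser of a position of `m₀`.**  `R ⊆ ∏_l Sym(n_l)` closed
under products and inverses, non-empty; `n_{m₀} = n_m = 4`; `R` `2`-transitive on the slot `m₀` and transitive on the slot `m`; every tuple of `R` trivial at `m₀` is
trivial at `m`.  Then for each `a : Fin (n m)` some `b : Fin (n m₀)` has `π m a = a ↔ π m₀ b = b` for all `π ∈ R`. [cite: DixonMortimer1996, §1.4 Ex. 1.4.1–1.4.2; §2.1] -/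
theorem exists_apply_eq_iff_of_noMover_four (hmul : ∀ π ∈ R, ∀ π' ∈ R, π * π' ∈ R) (hinv : ∀ π ∈ R, π⁻¹ ∈ R) (hne : R.Nonempty) {m₀ m : Fin r}
    (h4₀ : n m₀ = 4) (h4 : n m = 4) (h2t : ∀ a b a' b' : Fin (n m₀), a ≠ b → a' ≠ b' → ∃ π ∈ R, π m₀ a = a' ∧ π m₀ b = b')
    (htr : ∀ a a' : Fin (n m), ∃ π ∈ R, π m a = a') (hno : ∀ a : Fin (n m), ∀ ν ∈ R, ν m₀ = 1 → ν m a = a) (a : Fin (n m)) :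
    ∃ b : Fin (n m₀), ∀ π ∈ R, π m a = a ↔ π m₀ b = b := by
  classical
  let Gs : Subgroup (PermsG n) :=
    { carrier := ↑R
      mul_mem' := fun {π π'} hπ hπ' => hmul π hπ π' hπ'
      one_mem' := one_mem_of_closed hmul hinv hne
      inv_mem' := fun {π} hπ => hinv π hπ }
  let ev : ∀ l : Fin r, ↥Gs →* Equiv.Perm (Fin (n l)) := fun l => (Pi.evalMonoidHom (fun l : Fin r => Equiv.Perm (Fin (n l))) l).comp Gs.subtype
  have hev : ∀ (l : Fin r) (g : ↥Gs), ev l g = (g : PermsG n) l := fun l g => rfl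
  have h2t' : ∀ x y x' y' : Fin (n m₀), x ≠ y → x' ≠ y' → ∃ g : ↥Gs, ev m₀ g x = x' ∧ ev m₀ g y = y' := fun x y x' y' hxy hxy' => by
    obtain ⟨π, hπ, h, h'⟩ := h2t x y x' y' hxy hxy'
    exact ⟨⟨π, hπ⟩, h, h'⟩
  have htr' : ∀ x y : Fin (n m), ∃ g : ↥Gs, ev m g x = y := fun x y => by
    obtain ⟨π, hπ, h⟩ := htr x y
    exact ⟨⟨π, hπ⟩, h⟩
  have hker : (ev m₀).ker ≤ (ev m).ker := fun g hg => by
    rw [MonoidHom.mem_ker, hev] at hg ⊢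
    ext x
    exact congrArg Fin.val (hno x (g : PermsG n) g.2 hg)
  obtain ⟨b, hb⟩ := exists_apply_eq_iff_of_ker_le_of_twoTransitive_four (by rw [Fintype.card_fin, h4₀]) (by rw [Fintype.card_fin, h4])
    (ev m₀) (ev m) h2t' htr' hker a
  exact ⟨b, fun π hπ => hb ⟨π, hπ⟩⟩

end Model

/-! ## §3 Two bridges: automorphisms of `ℂ` fixing embeddings fix the Galois closure; for CM fields the `τ`-embeddings suffice -/

section Bridges

/-- **An automorphism of `ℂ` fixing every complex embedding of a number field `K` fixes the Galois closure `L(K)` of `K` in `ℂ` pointwise** (`L(K)` is the subfield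
generated by the images of the embeddings, Mathlib `normalClosure_le_iff`). [cite: Lang2002, VI §1 Thm. 1.1] -/
theorem apply_eq_self_of_mem_normalClosure {K : Type} [Field K] [NumberField K] (ρ : ℂ ≃+* ℂ) (h : ∀ u : K →+* ℂ, (ρ : ℂ →+* ℂ).comp u = u)
    {z : ℂ} (hz : z ∈ normalClosure ℚ K ℂ) : ρ z = z := by
  let Fix : IntermediateField ℚ ℂ := ((ρ : ℂ →+* ℂ).eqLocusField (RingHom.id ℂ)).toIntermediateField fun q =>
    RingHom.congr_fun (Subsingleton.elim ((ρ : ℂ →+* ℂ).comp (algebraMap ℚ ℂ)) ((RingHom.id ℂ).comp (algebraMap ℚ ℂ))) q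
  have hle : normalClosure ℚ K ℂ ≤ Fix := normalClosure_le_iff.2 fun f => by
    rintro _ ⟨y, rfl⟩
    exact RingHom.congr_fun (h (f : K →+* ℂ)) y
  exact hle hz

/-- **For a CM field through an imaginary quadratic field, fixing the `τ`-embeddings fixes all embeddings.**  `K` a CM field, `i : k → K`, `[k : ℚ] = 2`, `τ : k → ℂ`; if an
automorphism `ρ` of `ℂ` fixes every embedding `u` of `K` over `τ` (`ρ ∘ u = u`), it fixes every embedding `v` of `K`: `v` lies over `τ` or over `τ̄`, and in the latter
case `v = ū ∘ c_K`... precisely `v(x) = conj(v̄(x)) = v̄(c_K x)` with `v̄` over `τ` (Mathlib `IsCMField.complexEmbedding_complexConj`). [cite: Shimura1998, §18.2 Lemma (i)] -/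
theorem comp_eq_of_forall_comp_eq_over {k K : Type} [Field k] [NumberField k] [IsCMField k] [Field K] [NumberField K] [IsCMField K]
    (h2 : Module.finrank ℚ k = 2)
    (i : k →+* K) (τ : k →+* ℂ) (ρ : ℂ ≃+* ℂ) (h : ∀ u : K →+* ℂ, u.comp i = τ → (ρ : ℂ →+* ℂ).comp u = u) (v : K →+* ℂ) :
    (ρ : ℂ →+* ℂ).comp v = v := by
  rcases QuarticCM.eq_or_eq_conjugate_of_quadratic h2 τ (v.comp i) with hv | hv
  · exact h v hv
  · have hu : (ComplexEmbedding.conjugate v).comp i = τ := by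
      rw [ComplexEmbedding.conjugate_comp, hv]
      exact ComplexEmbedding.involutive_conjugate k τ
    have hfix := h _ hu
    ext x
    have hx : v x = ComplexEmbedding.conjugate v (IsCMField.complexConj K x) := by
      rw [ComplexEmbedding.conjugate_coe_eq, IsCMField.complexEmbedding_complexConj, Complex.conj_conj]
    rw [RingHom.comp_apply, hx]
    exact RingHom.congr_fun hfix _

end Bridges

/-! ## §4 The 𝔖₄ lemma: non-isomorphic octic CM fields through `k` lie outside each other's Galois closures -/

section Octic

variable {I : Type} {r : ℕ} {Kf : I → Type} [∀ i, Field (Kf i)] [∀ i, NumberField (Kf i)] [∀ i, IsCMField (Kf i)]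
  {i₀ : I} {is : Fin r → I} {n : Fin r → ℕ} {τ : Kf i₀ →+* ℂ}

/-- **THE 𝔖₄ LEMMA — NON-ISOMORPHIC OCTIC CM FIELDS THROUGH `k`, ONE WITH `2`-TRANSITIVE QUARTIC PART, LIE OUTSIDE EACH OTHER'S GALOIS CLOSURES.**  `k = Kf i₀`
imaginary quadratic, `[K_l : ℚ] = 2 n_l` along `i_l : k → K_l`, `n_{m₀} = n_m = 4`; the automorphisms of `ℂ` over `τ(k)` `2`-transitive on the four `τ`-embeddings of
`K_{m₀}`; NO ring homomorphism `K_m → K_{m₀}`.  Then some `τ`-embedding of `K_m` takes some value outside `L(K_{m₀})`.  (No mover ⟹ by §1–§2 a `τ`-embedding `s` of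
`K_m` and a `τ`-embedding `u` of `K_{m₀}` with one stabiliser in `Aut(ℂ/τk)` ⟹ `s(K_m) ⊆ u(K_{m₀})` ⟹ `u⁻¹ ∘ s ∈ Hom(K_m, K_{m₀})`.)
[cite: DixonMortimer1996, §1.4 Ex. 1.4.1–1.4.2; §2.1] [cite: Lang2002, VI §1 Thm. 1.1, Cor. 1.6; V §2 Thm. 2.8] [cite: Shimura1998, §18.2 Lemma (i)] -/
theorem exists_outside_normalClosure_of_isEmpty_ringHom_four (h2 : Module.finrank ℚ (Kf i₀) = 2)
    (hdeg : ∀ l : Fin r, Module.finrank ℚ (Kf (is l)) = 2 * n l) (im : ∀ l : Fin r, Kf i₀ →+* Kf (is l)) (m₀ m : Fin r) (h4₀ : n m₀ = 4) (h4 : n m = 4)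
    (h2T : ∀ s₁ s₂ s₁' s₂' : Kf (is m₀) →+* ℂ, s₁.comp (im m₀) = τ → s₂.comp (im m₀) = τ → s₁'.comp (im m₀) = τ → s₂'.comp (im m₀) = τ → s₁ ≠ s₂ →
      s₁' ≠ s₂' → ∃ ρ : ℂ ≃+* ℂ, (ρ : ℂ →+* ℂ).comp τ = τ ∧ (ρ : ℂ →+* ℂ).comp s₁ = s₁' ∧ (ρ : ℂ →+* ℂ).comp s₂ = s₂')
    (hK : IsEmpty (Kf (is m) →+* Kf (is m₀))) :
    ∃ s : Kf (is m) →+* ℂ, s.comp (im m) = τ ∧ ∃ x, s x ∉ normalClosure ℚ (Kf (is m₀)) ℂ := by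
  by_contra hall
  push Not at hall
  -- frames on all slots and the realised tuples
  have hττ : ComplexEmbedding.conjugate τ ≠ τ := QuarticCM.conjugate_ne τ
  have hk : ∀ σ : Kf i₀ →+* ℂ, σ = τ ∨ σ = ComplexEmbedding.conjugate τ := fun σ => QuarticCM.eq_or_eq_conjugate_of_quadratic h2 τ σ
  have hfr : ∀ l : Fin r, ∃ e : (Kf (is l) →+* ℂ) ≃ Fin (n l) × Bool, (∀ t, (e t).2 = true ↔ t.comp (im l) = τ) ∧
      ∀ t, e (ComplexEmbedding.conjugate t) = ((e t).1, !(e t).2) := fun l => exists_signFrame (hdeg l) h2 (im l) hττ hk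
  choose e he_sign _ using hfr
  have hs : ∀ (l : Fin r) (x : Fin (n l)), ((e l).symm (x, true)).comp (im l) = τ := fun l x => (he_sign l _).1 (by rw [Equiv.apply_symm_apply])
  have hsymm : ∀ (l : Fin r) (t : Kf (is l) →+* ℂ), t.comp (im l) = τ → (e l).symm ((e l t).1, true) = t := fun l t ht => by
    rw [show ((e l t).1, true) = e l t from Prod.ext rfl ((he_sign l t).2 ht).symm, Equiv.symm_apply_apply]
  -- NO MOVER: a realised tuple trivial at `m₀` comes from an automorphism fixing every `τ`-embedding of `K_{m₀}`, hence every embedding (CM), hence `L(K_{m₀})`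
  -- pointwise, hence every `τ`-embedding of `K_m` (all their values lie in `L(K_{m₀})`)
  have hno : ∀ a : Fin (n m), ∀ ν ∈ realisedTuples e τ, ν m₀ = 1 → ν m a = a := fun a ν hν hν₀ => by
    obtain ⟨ρ, -, hρ⟩ := (mem_realisedTuples e τ ν).1 hν
    have hfixτ : ∀ u : Kf (is m₀) →+* ℂ, u.comp (im m₀) = τ → (ρ : ℂ →+* ℂ).comp u = u := fun u hu => by
      have h := hρ m₀ (e m₀ u).1
      rwa [hν₀, Equiv.Perm.one_apply, hsymm m₀ u hu] at h
    have hfix : ∀ v : Kf (is m₀) →+* ℂ, (ρ : ℂ →+* ℂ).comp v = v := comp_eq_of_forall_comp_eq_over h2 (im m₀) τ ρ hfixτ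
    have h1 := hρ m a
    have h2' : (ρ : ℂ →+* ℂ).comp ((e m).symm (a, true)) = (e m).symm (a, true) :=
      RingHom.ext fun x => apply_eq_self_of_mem_normalClosure ρ hfix (hall _ (hs m a) x)
    rw [h2'] at h1
    exact (congrArg Prod.fst ((e m).symm.injective h1)).symm
  -- the group theory: a position `b` of the slot `m₀` with the stabiliser of the position `a₀` of the slot `m`
  let a₀ : Fin (n m) := ⟨0, by rw [h4]; norm_num⟩
  obtain ⟨b, hb⟩ := exists_apply_eq_iff_of_noMover_four (fun _ hπ _ hπ' => mul_mem_realisedTuples e τ hπ hπ') (fun _ hπ => inv_mem_realisedTuples hπ)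
    (realisedTuples_nonempty (e := e) he_sign) h4₀ h4 (twoTransitive_realisedTuples_of_aut (e := e) he_sign m₀ h2T)
    (fun x y => transitive_realisedTuples (e := e) he_sign m x y) hno a₀
  set s : Kf (is m) →+* ℂ := (e m).symm (a₀, true) with hsdef
  set u : Kf (is m₀) →+* ℂ := (e m₀).symm (b, true) with hudef
  -- `s(K_m) ⊆ u(K_{m₀})`: a value of `s` outside `u(K_{m₀})` is moved by an automorphism fixing `u(K_{m₀})`, which fixes `u`, `τ`, hence `s`
  haveI : FiniteDimensional ℚ ↥(adjoin ℚ (Set.range u)) :=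
    Module.finite_of_finrank_pos (by rw [finrank_adjoin_range_ringHom u]; exact Module.finrank_pos)
  have hsub : ∀ x, s x ∈ adjoin ℚ (Set.range u) := fun x => by
    by_contra hx
    obtain ⟨ρ, hρM, hρs⟩ := exists_ringEquiv_fix_comp_ne_of_apply_not_mem (adjoin ℚ (Set.range u)) s hx
    have hρu : (ρ : ℂ →+* ℂ).comp u = u := RingHom.ext fun y => hρM _ (subset_adjoin ℚ _ ⟨y, rfl⟩)
    have hρτ : (ρ : ℂ →+* ℂ).comp τ = τ := by rw [← hs m₀ b, ← hudef, ← RingHom.comp_assoc, hρu]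
    obtain ⟨π, hπ, hπρ⟩ := exists_mem_realisedTuples_of_comp_tau_eq (e := e) he_sign ρ hρτ
    have hπb : π m₀ b = b := by
      have h := hπρ m₀ b
      rw [← hudef, hρu] at h
      exact (congrArg Prod.fst ((e m₀).symm.injective h)).symm
    have hπa : π m a₀ = a₀ := (hb π hπ).2 hπb
    refine hρs ?_
    have h := hπρ m a₀
    rw [hπa] at h
    exact h
  -- hence a ring homomorphism `K_m → K_{m₀}`
  have hle : (s.toRatAlgHom).fieldRange ≤ (u.toRatAlgHom).fieldRange := by
    rintro _ ⟨x, rfl⟩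
    have h := hsub x
    rw [adjoin_range_ringHom_eq_fieldRange] at h
    exact h
  exact hK.false (((AlgEquiv.ofInjectiveField u.toRatAlgHom).symm.toAlgHom.comp
    ((IntermediateField.inclusion hle).comp (AlgEquiv.ofInjectiveField s.toRatAlgHom).toAlgHom)).toRingHom)

/-- **Every embedding form**: under the same hypotheses EVERY complex embedding of `K_m` (over `τ` or not) takes a value outside `L(K_{m₀})` (`Aut(ℂ)` is transitive on the
embeddings of `K_m` and preserves the normal subfield `L(K_{m₀})`). [cite: Shimura1998, §18.2 Lemma (i)] [cite: Lang2002, VI §1 Thm. 1.1 and V §2 Thm. 2.8] -/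
theorem forall_exists_outside_normalClosure_of_isEmpty_ringHom_four (h2 : Module.finrank ℚ (Kf i₀) = 2)
    (hdeg : ∀ l : Fin r, Module.finrank ℚ (Kf (is l)) = 2 * n l) (im : ∀ l : Fin r, Kf i₀ →+* Kf (is l)) (m₀ m : Fin r) (h4₀ : n m₀ = 4) (h4 : n m = 4)
    (h2T : ∀ s₁ s₂ s₁' s₂' : Kf (is m₀) →+* ℂ, s₁.comp (im m₀) = τ → s₂.comp (im m₀) = τ → s₁'.comp (im m₀) = τ → s₂'.comp (im m₀) = τ → s₁ ≠ s₂ →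
      s₁' ≠ s₂' → ∃ ρ : ℂ ≃+* ℂ, (ρ : ℂ →+* ℂ).comp τ = τ ∧ (ρ : ℂ →+* ℂ).comp s₁ = s₁' ∧ (ρ : ℂ →+* ℂ).comp s₂ = s₂')
    (hK : IsEmpty (Kf (is m) →+* Kf (is m₀))) (s' : Kf (is m) →+* ℂ) : ∃ x, s' x ∉ normalClosure ℚ (Kf (is m₀)) ℂ := by
  obtain ⟨s, hs, x, hx⟩ := exists_outside_normalClosure_of_isEmpty_ringHom_four h2 hdeg im m₀ m h4₀ h4 h2T hK
  -- an automorphism of `ℂ` carrying `s` to `s'` (both over `τ`); it preserves `L(K_{m₀})`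
  haveI : Countable (Kf (is m)) := Countable.of_equiv _ (Module.finBasis ℚ (Kf (is m))).equivFun.toEquiv.symm
  obtain ⟨ρ, hρ⟩ := ZarhinLie.exists_ringEquiv_complex_comp_eq s s'
  refine ⟨x, fun hx' => hx ?_⟩
  -- `ρ⁻¹` maps the normal subfield `L(K_{m₀})` into itself
  haveI := Literature.NumberTheory.NumberFields.isGalois_normalClosure_complex (Kf (is m₀))
  have h := AlgHom.restrictNormal_commutes (ρ.symm : ℂ →+* ℂ).toRatAlgHom ↥(normalClosure ℚ (Kf (is m₀)) ℂ) ⟨s' x, hx'⟩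
  have hsx : s x = ρ.symm (s' x) := by rw [RingEquiv.eq_symm_apply]; exact hρ x
  have h' : s x = (((ρ.symm : ℂ →+* ℂ).toRatAlgHom.restrictNormal ↥(normalClosure ℚ (Kf (is m₀)) ℂ) ⟨s' x, hx'⟩ :
      ↥(normalClosure ℚ (Kf (is m₀)) ℂ)) : ℂ) := hsx.trans h.symm
  rw [h']
  exact SetLike.coe_mem _

end Octic


end Summit.HodgeConjecture.CorCM.MultiFieldWeil

end
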